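import Summits.CriticalPhenomena.Ising3DConformalLimit.Theorems.StrandShadow.Negative.ClusterDecomposition
import HarnessLib

/-!
# Route `FKParityRobustness`, crux `StrandShadow` (stmt-CriticalPhenomena-14626), line
# `odd-cluster-cut-exact-helper`: the two-cluster fibre bijection and the sprinkle sums

Helper file 1/3 behind the registered stub `stub_oddClusterCutFirstMoment` (the first-moment
identity `M₁(K,K′) = W(K,K′) · t⁴ Σ ⟨σ_uσ_v⟩^free_H ⟨σ_uσ_v⟩^free_G` of the line), finite-graph
combinatorics only (no currents, no Ising measure):

* `oddCutFM_twoCluster_sum` / `oddCutFM_twoClusterFibreSum` (registered form) — the TWO-CLUSTER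
  FIBRE BIJECTION: for a pairing cluster pair `(K, K′)` of a finite graph `G` (self-clustered at
  `a₀` resp. `a₂`, odd sets `{a₀,a₁}` resp. `{a₂,a₃}`, vertex-disjoint; `clusterIndex` of
  `ClusterDecomposition.lean`) the `{a₀,a₁,a₂,a₃}`-joins `F` with `K_{a₀}(F) = K`, `K_{a₂}(F) = K′`
  are exactly `F = K ⊔ K′ ⊔ R`, `R` an EVEN subgraph of the holed edge set `ω` (edges of `G`
  avoiding `V(K) ∪ V(K′)`): `Σ_{F in the fibre} g(F) = Σ_{R ∈ 𝒯_∅(ω)} g(K ∪ K′ ∪ R)`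
  (two-cluster version of `fibre_sum`, ibid.);
* `oddCutFM_sum_powerset_split` (`𝒫(E) ≃ 𝒫(E₁) × 𝒫(E ∖ E₁)`), `oddCutFM_sum_powerset_supset`
  (`Σ_{T ⊆ η ⊆ S} a^{|η|} b^{|S|−|η|} = a^{|T|}(a+b)^{|S|−|T|}`), `oddCutFM_eta_sum` (the Bernoulli
  product weight factorises over `E₁ ⊔ (E ∖ E₁)` and two prescribed outside coordinates cost
  `a²` when `a + b = 1` — the "`t⁴`" of the line);
* `oddCutFM_sum_tJoins_eq_hteSum` — `T`-joins of `G` inside the edges of a volume `H` are the index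
  set of the high-temperature sum `g_H(A)` (`hteSum`, `ModifiedSimonInequality.lean`).

References: M. Aizenman, H. Duminil-Copin, V. Sidoravicius, Comm. Math. Phys. 334 (2015), Lemma 2.2
[AizenmanDuminilCopinSidoraviciusCMP2015]; G. Grimmett, S. Janson, Electron. J. Combin. 16 (2009)
[GrimmettJanson2007] (even subgraphs).
-/

noncomputable section

open Finset SimpleGraph
open Literature.Probability.LatticeModels

namespace Summit.CriticalPhenomena.Ising3DConformalLimit.Theorems.StrandShadowOddCut

open scoped Classical
open Summit.CriticalPhenomena.Ising3DConformalLimit.StrandShadowNegative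

/-! ## Part A. The two-cluster fibre bijection `F ↦ F ∖ (K ∪ K′)`, `R ↦ K ∪ K′ ∪ R` -/

section TwoCluster

variable {V : Type*} [Fintype V] [DecidableEq V] (G : SimpleGraph V) [DecidableRel G.Adj]

omit [Fintype V] in
/-- The second terminal of a cluster of the index set is reachable inside it. -/
private theorem oddCutFM_rch_snd {K : Finset (Sym2 V)} {x y : V}
    (hKself : clusterEdges K x = K) (hKodd : ∀ v, Odd (edeg K v) ↔ v ∈ ({x, y} : Finset V)) :
    Rch K x y :=
  rch_of_edeg_ne_zero hKself fun h0 => by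
    have := (hKodd y).2 (by simp); rw [h0] at this; exact Nat.not_odd_zero this

/-- **Two-cluster fibre bijection.** For a pairing cluster pair `(K, K′)` (self-clustered at
`a₀` resp. `a₂`, odd sets `{a₀,a₁}` resp. `{a₂,a₃}`, vertex-disjoint) the `{a₀,a₁,a₂,a₃}`-joins
`F` with `K_{a₀}(F) = K`, `K_{a₂}(F) = K′` are exactly `F = K ⊔ K′ ⊔ R` with `R` an even
subgraph of the holed edge set `ω` (edges of `G` avoiding `V(K) ∪ V(K′)`). -/
theorem oddCutFM_twoCluster_sum {K K' : Finset (Sym2 V)} {a₀ a₁ a₂ a₃ : V}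
    (hK : K ∈ clusterIndex G a₀ a₁ a₂ a₃) (hK' : K' ∈ clusterIndex G a₂ a₃ a₀ a₁)
    (hdis : ∀ v, Rch K a₀ v → ¬ Rch K' a₂ v) {ω : Set (Sym2 V)}
    (hω : ∀ e ∈ G.edgeSet, e ∈ ω ↔ ∀ z ∈ e, ¬ Rch K a₀ z ∧ ¬ Rch K' a₂ z)
    (g : Finset (Sym2 V) → ℝ) :
    ∑ F ∈ (tJoins G Set.univ ({a₀, a₁} ∪ {a₂, a₃})).filter
        (fun F => clusterEdges F a₀ = K ∧ clusterEdges F a₂ = K'), g F =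
      ∑ R ∈ tJoins G ω ∅, g (K ∪ K' ∪ R) := by
  obtain ⟨hKG, hKself, hKodd, hK2, hK3⟩ := (mem_clusterIndex G).1 hK
  obtain ⟨hK'G, hK'self, hK'odd, hK'0, hK'1⟩ := (mem_clusterIndex G).1 hK'
  have hdis' : ∀ v, Rch K' a₂ v → ¬ Rch K a₀ v := fun v h h' => hdis v h' h
  have h01 : Rch K a₀ a₁ := oddCutFM_rch_snd hKself hKodd
  have h23 : Rch K' a₂ a₃ := oddCutFM_rch_snd hK'self hK'odd
  -- `K′` avoids `V(K)` and `K` avoids `V(K′)`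
  have hK'av : ∀ e ∈ K', ∀ v ∈ e, ¬ Rch K a₀ v := fun e he v hv =>
    hdis' v (rch_of_mem_of_self hK'self he hv)
  have hKav : ∀ e ∈ K, ∀ v ∈ e, ¬ Rch K' a₂ v := fun e he v hv =>
    hdis v (rch_of_mem_of_self hKself he hv)
  have hKK' : Disjoint K K' := disjoint_of_avoid hKself hK'av
  -- membership in the source set
  have hS : ∀ v, v ∈ ({a₀, a₁} ∪ {a₂, a₃} : Finset V) → Rch K a₀ v ∨ Rch K' a₂ v := by
    intro v hv
    simp only [mem_union, mem_insert, mem_singleton] at hv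
    rcases hv with (rfl | rfl) | (rfl | rfl)
    exacts [Or.inl (rch_refl K _), Or.inl h01, Or.inr (rch_refl K' _), Or.inr h23]
  refine Finset.sum_bij' (fun F _ => F \ (K ∪ K')) (fun R _ => K ∪ K' ∪ R) ?_ ?_ ?_ ?_ ?_
  · -- `F ↦ F ∖ (K ∪ K′)` lands in the even subgraphs of `ω`
    intro F hF
    rw [mem_filter, mem_tJoins_univ] at hF
    obtain ⟨⟨hFG, hFodd⟩, hcl, hcl'⟩ := hF
    have hav : ∀ e ∈ F \ (K ∪ K'), ∀ v ∈ e, ¬ Rch K a₀ v ∧ ¬ Rch K' a₂ v := by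
      intro e he v hv
      rw [mem_sdiff, mem_union, not_or] at he
      refine ⟨?_, ?_⟩
      · have := sdiff_clusterEdges_avoid F a₀ e (by rw [mem_sdiff, hcl]; exact ⟨he.1, he.2.1⟩) v hv
        rwa [hcl] at this
      · have := sdiff_clusterEdges_avoid F a₂ e (by rw [mem_sdiff, hcl']; exact ⟨he.1, he.2.2⟩) v hv
        rwa [hcl'] at this
    have hKUF : K ∪ K' ⊆ F := union_subset (hcl ▸ clusterEdges_subset F a₀) (hcl' ▸ clusterEdges_subset F a₂)
    rw [mem_tJoins]
    refine ⟨fun e he => hFG (mem_sdiff.1 he).1, fun e he => ?_, fun v => ?_⟩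
    · have he' : e ∈ F \ (K ∪ K') := mem_coe.1 he
      exact (hω e (SimpleGraph.mem_edgeFinset.1 (hFG (mem_sdiff.1 he').1))).2 (hav e he')
    · simp only [Finset.notMem_empty, iff_false]
      change ¬ Odd (edeg (F \ (K ∪ K')) v)
      by_cases hv : Rch K a₀ v ∨ Rch K' a₂ v
      · rw [edeg_eq_zero_of_avoid fun e he hve => ?_]
        · exact Nat.not_odd_zero
        · rcases hv with hv | hv
          exacts [(hav e he v hve).1 hv, (hav e he v hve).2 hv]
      · rw [not_or] at hv
        have hdeg : edeg F v = edeg (K ∪ K') v + edeg (F \ (K ∪ K')) v := by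
          rw [← edeg_union disjoint_sdiff, union_sdiff_of_subset hKUF]
        rw [edeg_union hKK', edeg_eq_zero_of_not_rch hKself hv.1,
          edeg_eq_zero_of_not_rch hK'self hv.2, zero_add, zero_add] at hdeg
        rw [← hdeg, hFodd v]
        exact fun h => (hS v h).elim hv.1 hv.2
  · -- `R ↦ K ∪ K′ ∪ R` lands in the fibre
    intro R hR
    rw [mem_tJoins] at hR
    obtain ⟨hRG, hRω, hRodd⟩ := hR
    have hRav : ∀ e ∈ R, ∀ v ∈ e, ¬ Rch K a₀ v ∧ ¬ Rch K' a₂ v := fun e he =>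
      (hω e (SimpleGraph.mem_edgeFinset.1 (hRG he))).1 (hRω (mem_coe.2 he))
    have hKR : Disjoint K R := disjoint_of_avoid hKself fun e he v hv => (hRav e he v hv).1
    have hK'R : Disjoint K' R := disjoint_of_avoid hK'self fun e he v hv => (hRav e he v hv).2
    rw [mem_filter, mem_tJoins_univ]
    refine ⟨⟨?_, fun v => ?_⟩, ?_, ?_⟩
    · exact union_subset (union_subset hKG hK'G) hRG
    · rw [edeg_union (disjoint_union_left.2 ⟨hKR, hK'R⟩), edeg_union hKK']
      by_cases hv : Rch K a₀ v
      · rw [edeg_eq_zero_of_not_rch hK'self (hdis v hv),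
          edeg_eq_zero_of_avoid fun e he hve => (hRav e he v hve).1 hv, add_zero, add_zero, hKodd v,
          mem_union]
        refine ⟨Or.inl, fun h => h.elim id fun h => ?_⟩
        simp only [mem_insert, mem_singleton] at h
        rcases h with rfl | rfl
        exacts [absurd hv hK2, absurd hv hK3]
      by_cases hv' : Rch K' a₂ v
      · rw [edeg_eq_zero_of_not_rch hKself hv,
          edeg_eq_zero_of_avoid fun e he hve => (hRav e he v hve).2 hv', zero_add, add_zero,
          hK'odd v, mem_union]
        refine ⟨Or.inr, fun h => h.elim (fun h => ?_) id⟩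
        simp only [mem_insert, mem_singleton] at h
        rcases h with rfl | rfl
        exacts [absurd hv' hK'0, absurd hv' hK'1]
      · rw [edeg_eq_zero_of_not_rch hKself hv, edeg_eq_zero_of_not_rch hK'self hv', zero_add,
          zero_add]
        have hR0 : ¬ Odd (edeg R v) := by
          have := hRodd v; simp only [Finset.notMem_empty, iff_false] at this; exact this
        exact ⟨fun h => absurd h hR0, fun h => ((hS v h).elim hv hv').elim⟩
    · rw [union_assoc]
      exact clusterEdges_union_eq hKself fun e he v hv => by
        rcases mem_union.1 he with h | h
        exacts [hK'av e h v hv, (hRav e h v hv).1]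
    · rw [union_comm K K', union_assoc]
      exact clusterEdges_union_eq hK'self fun e he v hv => by
        rcases mem_union.1 he with h | h
        exacts [hKav e h v hv, (hRav e h v hv).2]
  · intro F hF
    rw [mem_filter] at hF
    exact union_sdiff_of_subset (union_subset (hF.2.1 ▸ clusterEdges_subset F a₀)
      (hF.2.2 ▸ clusterEdges_subset F a₂))
  · intro R hR
    rw [mem_tJoins] at hR
    have hRav : ∀ e ∈ R, ∀ v ∈ e, ¬ Rch K a₀ v ∧ ¬ Rch K' a₂ v := fun e he =>
      (hω e (SimpleGraph.mem_edgeFinset.1 (hR.1 he))).1 (hR.2.1 (mem_coe.2 he))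
    exact union_sdiff_cancel_left (disjoint_union_left.2
      ⟨disjoint_of_avoid hKself fun e he v hv => (hRav e he v hv).1,
        disjoint_of_avoid hK'self fun e he v hv => (hRav e he v hv).2⟩)
  · intro F hF
    rw [mem_filter] at hF
    rw [union_sdiff_of_subset (union_subset (hF.2.1 ▸ clusterEdges_subset F a₀)
      (hF.2.2 ▸ clusterEdges_subset F a₂))]

end TwoCluster

/-! ## Part B. Finset algebra: splitting a powerset sum, supersets of a fixed set, `T`-joins
inside a volume as the high-temperature index set -/

section FinsetAlgebra

/-- Splitting a sum over `𝒫(E)` along `E = E₁ ⊔ (E ∖ E₁)`. -/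
theorem oddCutFM_sum_powerset_split {α M : Type*} [DecidableEq α] [AddCommMonoid M]
    {E₁ E : Finset α} (h : E₁ ⊆ E) (φ : Finset α → M) :
    ∑ η ∈ E.powerset, φ η = ∑ η₁ ∈ E₁.powerset, ∑ η₂ ∈ (E \ E₁).powerset, φ (η₁ ∪ η₂) := by
  have hprod : (∑ η₁ ∈ E₁.powerset, ∑ η₂ ∈ (E \ E₁).powerset, φ (η₁ ∪ η₂)) =
      ∑ p ∈ E₁.powerset ×ˢ (E \ E₁).powerset, φ (p.1 ∪ p.2) :=
    (Finset.sum_product _ _ (fun p => φ (p.1 ∪ p.2))).symm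
  rw [hprod]
  symm
  refine Finset.sum_nbij' (fun p => p.1 ∪ p.2) (fun η => (η ∩ E₁, η \ E₁)) ?_ ?_ ?_ ?_
    (fun _ _ => rfl)
  · rintro ⟨η₁, η₂⟩ hp
    rw [Finset.mem_product, Finset.mem_powerset, Finset.mem_powerset] at hp
    exact Finset.mem_powerset.2 (union_subset (hp.1.trans h) (hp.2.trans sdiff_subset))
  · intro η hη
    rw [Finset.mem_powerset] at hη
    rw [Finset.mem_product, Finset.mem_powerset, Finset.mem_powerset]
    exact ⟨inter_subset_right, sdiff_subset_sdiff hη subset_rfl⟩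
  · rintro ⟨η₁, η₂⟩ hp
    rw [Finset.mem_product, Finset.mem_powerset, Finset.mem_powerset] at hp
    obtain ⟨h₁, h₂⟩ := hp
    ext e
    · simp only [mem_inter, mem_union]
      exact ⟨fun ⟨h, he⟩ => h.elim id fun h' => absurd he (mem_sdiff.1 (h₂ h')).2,
        fun he => ⟨Or.inl he, h₁ he⟩⟩
    · simp only [mem_sdiff, mem_union]
      exact ⟨fun ⟨h, he⟩ => h.elim (fun h' => absurd (h₁ h') he) id,
        fun he => ⟨Or.inr he, (mem_sdiff.1 (h₂ he)).2⟩⟩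
  · intro η _
    ext e
    simp only [mem_union, mem_inter, mem_sdiff]
    tauto

/-- `Σ_{T ⊆ η ⊆ S} a^{|η|} b^{|S| − |η|} = a^{|T|} (a + b)^{|S| − |T|}` (binomial resummation of
the free coordinates). -/
theorem oddCutFM_sum_powerset_supset {α R : Type*} [DecidableEq α] [CommSemiring R]
    {T S : Finset α} (hT : T ⊆ S) (a b : R) :
    ∑ η ∈ S.powerset, (if T ⊆ η then a ^ #η * b ^ (#S - #η) else 0) =
      a ^ #T * (a + b) ^ (#S - #T) := by
  rw [← Finset.sum_filter, ← card_sdiff_of_subset hT, ← Finset.sum_pow_mul_eq_add_pow,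
    Finset.mul_sum]
  refine Finset.sum_nbij' (fun η => η \ T) (fun η' => T ∪ η') ?_ ?_ ?_ ?_ ?_
  · intro η hη
    rw [mem_filter, mem_powerset] at hη
    exact mem_powerset.2 (sdiff_subset_sdiff hη.1 subset_rfl)
  · intro η' hη'
    rw [mem_powerset] at hη'
    rw [mem_filter, mem_powerset]
    exact ⟨union_subset hT (hη'.trans sdiff_subset), subset_union_left⟩
  · intro η hη
    rw [mem_filter] at hη
    exact union_sdiff_of_subset hη.2
  · intro η' hη'
    rw [mem_powerset] at hη'
    exact union_sdiff_cancel_left (disjoint_of_subset_right hη' disjoint_sdiff)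
  · intro η hη
    rw [mem_filter, mem_powerset] at hη
    have h1 : #(η \ T) = #η - #T := card_sdiff_of_subset hη.2
    have h2 : #T ≤ #η := card_le_card hη.2
    have h3 : #η ≤ #S := card_le_card hη.1
    rw [h1, card_sdiff_of_subset hT, show #S - #T - (#η - #T) = #S - #η by omega, ← mul_assoc,
      ← pow_add, show #T + (#η - #T) = #η by omega]

variable {V : Type*} [Fintype V] [DecidableEq V] (G : SimpleGraph V) [DecidableRel G.Adj]

/-- `T`-joins of `G` inside an edge set `ω` = "edges of `G` inside the volume `H`" are the index
set of the high-temperature sum `g_H(A)` (`hteSum`), for `A ⊆ H`. -/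
theorem oddCutFM_sum_tJoins_eq_hteSum {ω : Set (Sym2 V)} {H : Finset V}
    (hω : ∀ e ∈ G.edgeSet, e ∈ ω ↔ ∀ z ∈ e, z ∈ H) {A : Finset V} (hA : A ⊆ H) (t : ℝ) :
    ∑ F ∈ tJoins G ω A, t ^ #F = hteSum G H t A := by
  unfold hteSum
  refine Finset.sum_congr ?_ fun _ _ => rfl
  ext F
  rw [mem_tJoins, mem_filter, mem_powerset]
  constructor
  · rintro ⟨hFE, hFω, hpar⟩
    have hFin : F ⊆ edgesIn G H := fun e he =>
      mem_edgesIn_iff.2 ⟨SimpleGraph.mem_edgeFinset.1 (hFE he),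
        (hω e (SimpleGraph.mem_edgeFinset.1 (hFE he))).1 (hFω (mem_coe.2 he))⟩
    refine ⟨hFin, ?_⟩
    ext v
    rw [oddVerts, mem_filter]
    exact ⟨fun h => (hpar v).1 h.2, fun h => ⟨hA h, (hpar v).2 h⟩⟩
  · rintro ⟨hFin, hodd⟩
    refine ⟨fun e he => SimpleGraph.mem_edgeFinset.2 (mem_edgesIn_iff.1 (hFin he)).1,
      fun e he => (hω e (mem_edgesIn_iff.1 (hFin (mem_coe.1 he))).1).2
        (mem_edgesIn_iff.1 (hFin (mem_coe.1 he))).2, fun v => ?_⟩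
    have hv := Finset.ext_iff.1 hodd v
    rw [oddVerts, mem_filter] at hv
    by_cases hvH : v ∈ H
    · exact ⟨fun h => hv.1 ⟨hvH, h⟩, fun h => (hv.2 h).2⟩
    · have h0 : F.filter (v ∈ ·) = ∅ :=
        filter_eq_empty_iff.2 fun e he hve => hvH ((mem_edgesIn_iff.1 (hFin he)).2 v hve)
      rw [h0, card_empty]
      exact ⟨fun h => absurd h Nat.not_odd_zero, fun h => absurd (hA h) hvH⟩

end FinsetAlgebra

/-! ## Part D. The sprinkle sum: the two attaching bonds cost exactly `t⁴` -/

section Sprinkle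

/-- **The `η`-sum.** Split `η = η₁ ⊔ η₂` along `E = E₁ ⊔ (E ∖ E₁)`; if the event `P η` only
depends on `η₁` (as `Q η₁`) and the two marked coordinates `e₁ ≠ e₂` lie in `E ∖ E₁`, then
`Σ_{η ⊆ E} a^{|η|} b^{|E|−|η|} 1[e₁, e₂ ∈ η, P η] = a² Σ_{η₁ ⊆ E₁} 1[Q η₁] a^{|η₁|} b^{|E₁|−|η₁|}`
when `a + b = 1` (binomial resummation of the free outside coordinates). -/
theorem oddCutFM_eta_sum {α : Type*} [DecidableEq α] {E₁ E : Finset α} (hE : E₁ ⊆ E)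
    {e₁ e₂ : α} (he₁ : e₁ ∈ E \ E₁) (he₂ : e₂ ∈ E \ E₁) (hne : e₁ ≠ e₂)
    (P Q : Finset α → Prop) [DecidablePred P] [DecidablePred Q]
    (hPQ : ∀ η₁, η₁ ⊆ E₁ → ∀ η₂, η₂ ⊆ E \ E₁ → (P (η₁ ∪ η₂) ↔ Q η₁)) (a b : ℝ)
    (hab : a + b = 1) :
    ∑ η ∈ E.powerset, a ^ #η * b ^ (#E - #η) * (if e₁ ∈ η ∧ e₂ ∈ η ∧ P η then 1 else 0) =
      a ^ 2 * ∑ η₁ ∈ E₁.powerset, if Q η₁ then a ^ #η₁ * b ^ (#E₁ - #η₁) else 0 := by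
  rw [oddCutFM_sum_powerset_split hE, Finset.mul_sum]
  refine Finset.sum_congr rfl fun η₁ hη₁ => ?_
  rw [mem_powerset] at hη₁
  have hT : ({e₁, e₂} : Finset α) ⊆ E \ E₁ := by
    intro e he
    simp only [mem_insert, mem_singleton] at he
    rcases he with rfl | rfl
    exacts [he₁, he₂]
  have hEE : #E = #E₁ + #(E \ E₁) := by
    rw [card_sdiff_of_subset hE]; have := card_le_card hE; omega
  have hinner : ∑ η₂ ∈ (E \ E₁).powerset, a ^ #(η₁ ∪ η₂) * b ^ (#E - #(η₁ ∪ η₂)) *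
      (if e₁ ∈ η₁ ∪ η₂ ∧ e₂ ∈ η₁ ∪ η₂ ∧ P (η₁ ∪ η₂) then (1 : ℝ) else 0) =
      (if Q η₁ then a ^ #η₁ * b ^ (#E₁ - #η₁) else 0) *
        ∑ η₂ ∈ (E \ E₁).powerset,
          (if {e₁, e₂} ⊆ η₂ then a ^ #η₂ * b ^ (#(E \ E₁) - #η₂) else 0) := by
    rw [Finset.mul_sum]
    refine Finset.sum_congr rfl fun η₂ hη₂ => ?_
    rw [mem_powerset] at hη₂
    have hdisj : Disjoint η₁ η₂ :=
      disjoint_of_subset_right hη₂ (disjoint_of_subset_left hη₁ disjoint_sdiff)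
    have hle₁ : #η₁ ≤ #E₁ := card_le_card hη₁
    have hle₂ : #η₂ ≤ #(E \ E₁) := card_le_card hη₂
    have he₁' : e₁ ∈ η₁ ∪ η₂ ↔ e₁ ∈ η₂ := by
      rw [mem_union]
      exact ⟨fun h => h.resolve_left fun h' => (mem_sdiff.1 he₁).2 (hη₁ h'), Or.inr⟩
    have he₂' : e₂ ∈ η₁ ∪ η₂ ↔ e₂ ∈ η₂ := by
      rw [mem_union]
      exact ⟨fun h => h.resolve_left fun h' => (mem_sdiff.1 he₂).2 (hη₁ h'), Or.inr⟩
    have hsub : ({e₁, e₂} : Finset α) ⊆ η₂ ↔ e₁ ∈ η₂ ∧ e₂ ∈ η₂ := by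
      rw [insert_subset_iff, singleton_subset_iff]
    rw [card_union_of_disjoint hdisj, pow_add,
      show #E - (#η₁ + #η₂) = (#E₁ - #η₁) + (#(E \ E₁) - #η₂) by omega, pow_add]
    by_cases hQ : Q η₁
    · by_cases h12 : e₁ ∈ η₂ ∧ e₂ ∈ η₂
      · rw [if_pos ⟨he₁'.2 h12.1, he₂'.2 h12.2, (hPQ η₁ hη₁ η₂ hη₂).2 hQ⟩, if_pos hQ,
          if_pos (hsub.2 h12)]
        ring
      · rw [if_neg (fun h => h12 ⟨he₁'.1 h.1, he₂'.1 h.2.1⟩), if_neg (fun h => h12 (hsub.1 h)),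
          mul_zero, mul_zero]
    · rw [if_neg (fun h => hQ ((hPQ η₁ hη₁ η₂ hη₂).1 h.2.2)), if_neg hQ, mul_zero, zero_mul]
  rw [hinner, oddCutFM_sum_powerset_supset hT, card_pair hne, hab, one_pow, mul_one, mul_comm]

end Sprinkle

section Registered

/-- **Two-cluster fibre bijection** (registered form of `oddCutFM_twoCluster_sum`): for a pairing
cluster pair `(K, K′)` of a finite graph and the holed edge set `ω`,
`Σ_{F ∈ 𝒯_{a₀a₁a₂a₃}(G), K_{a₀}(F) = K, K_{a₂}(F) = K′} g(F) = Σ_{R ∈ 𝒯_∅(ω)} g(K ∪ K′ ∪ R)`. -/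
theorem oddCutFM_twoClusterFibreSum :
    ∀ (V : Type) [Fintype V] [DecidableEq V] (G : SimpleGraph V) [DecidableRel G.Adj]
      (K K' : Finset (Sym2 V)) (a₀ a₁ a₂ a₃ : V), K ∈ clusterIndex G a₀ a₁ a₂ a₃ →
      K' ∈ clusterIndex G a₂ a₃ a₀ a₁ → (∀ v, Rch K a₀ v → ¬ Rch K' a₂ v) →
      ∀ (ω : Set (Sym2 V)), (∀ e ∈ G.edgeSet, e ∈ ω ↔ ∀ z ∈ e, ¬ Rch K a₀ z ∧ ¬ Rch K' a₂ z) →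
      ∀ g : Finset (Sym2 V) → ℝ,
      ∑ F ∈ (tJoins G Set.univ ({a₀, a₁} ∪ {a₂, a₃})).filter
          (fun F => clusterEdges F a₀ = K ∧ clusterEdges F a₂ = K'), g F =
        ∑ R ∈ tJoins G ω ∅, g (K ∪ K' ∪ R) :=
  fun _ _ _ G _ _ _ _ _ _ _ hK hK' hdis _ hω g => oddCutFM_twoCluster_sum G hK hK' hdis hω g

end Registered

end Summit.CriticalPhenomena.Ising3DConformalLimit.Theorems.StrandShadowOddCut

end
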